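/-
Copyright (c) 2026 the pub-hodgecm-mathlib formalisation cell (harness21).  Prover seat hodgecm-mathlib-LH5-p02 (g11): E1 row 47f R-f «A FINITELY SUPPORTED FUNCTION ON `ℤ × F`
KILLED BY ALL CHARACTERS IS ZERO» (E1 keeper ∕ dealer F0P3a-p03 (g29); census row 47 «NON-ELLIPTIC VANISHING OF `f_EP^{V,e}`» F0P3-p02 (g26) §2 (A5), §5 R47-f), 2026-09-03.
-/
import Mathlib.Analysis.Fourier.FiniteAbelian.PontryaginDuality
import Mathlib.Algebra.Polynomial.Roots
import Mathlib.GroupTheory.QuotientGroup.Basic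
import HarnessLib

/-!
# A finitely supported function killed by all characters is zero (`ℤ`, finite abelian groups, products; the `T ∕ T₁` packaging)

Topic `GroupTheory`; namespace `Literature.GroupTheory`.  THEOREMS ONLY (no definition, instance, notation or named fact); Mathlib-footed.  Cell `pub/hodgecm-mathlib`
(D-0151), crux H413 = `stmt-HodgeConjecture-24833`, lane `--supports`; E1 census row 47 «NON-ELLIPTIC VANISHING OF `f_EP^{V,e}`» (F0P3-p02 (g26)) §2 arrow (A5) «FOURIER
UNIQUENESS ON `T`», §5 row R47-f.  Count-neutral generic base layer; HC_CM is proved only modulo the 7 printed citations (2 remaining named inputs: hLiu418 =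
`stmt-HodgeConjecture-24832`, h413 = `stmt-HodgeConjecture-24833`) until rung 0 closes.

THE PROPERTY.  For an additive commutative group `A` say (inline, no definition) «`A` is CHARACTER-SEPARATED» if every finitely supported `Ψ : A →₀ ℂ` with
`Σ_a Ψ(a) ψ(a) = 0` for every character `ψ : AddChar A ℂ` vanishes (injectivity of the Fourier ∕ Gelfand transform on the group algebra `ℂ[A]`).
* §1 TRANSPORT AND PRODUCTS: the property passes along `A ≃+ B` and from `A`, `B` to `A × B` (fix a character of `B`, contract, apply `A`, then `B` fibrewise).
* §2 `ℤ`: a Laurent polynomial `Σ_n Ψ(n) zⁿ` vanishing at every `z ∈ ℂ^×` is zero (`z^{−min} · Σ` is a polynomial with infinitely many roots, Mathlib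
  `Polynomial.eq_zero_of_infinite_isRoot`; its constant coefficient is `Ψ(min)`); the characters `n ↦ zⁿ` are `AddChar ℤ ℂ`.
* §3 FINITE `A`: the characters form a basis of `A → ℂ` (Mathlib `AddChar.complexBasis`), so the indicator of a point is a combination of characters.
* §4 ASSEMBLY: `ℤ × F`, `F × ℤ` (`F` finite) and anything isomorphic to them are character-separated.
* §5 MULTIPLICATIVE GROUPS AND THE `T ∕ T₁` PACKAGING (census (A5): `T` the torus, `T₁` compact open, `D = T ∕ T₁ ≅ ℤ × (finite)`): for a commutative group `T`, a subgroup `T₁`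
  and `Ψ : T → ℂ` which is `T₁`-INVARIANT with FINITELY MANY VALUES-CARRYING COSETS, if `Σ_{c ∈ T∕T₁} Ψ(c) χ(c) = 0` for every homomorphism `χ : T →* ℂ` trivial on `T₁`, then
  `Ψ = 0` — given that `T ∕ T₁` is character-separated, in particular when `Additive (T ∕ T₁) ≃+ ℤ × F` with `F` finite
  (`eq_zero_of_forall_monoidHom_of_addEquiv_int_prod`).  The conversion of the torus integral `∫_T χ Ψ dμ_T` into this finite coset sum is the datum row R47-e.

## References
* [Laumon1995] G. Laumon, *Cohomology of Drinfeld Modular Varieties I* (1996), (5.6) (vanishing of non-elliptic orbital integrals via the torus), (4.8.10)–(4.8.11).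
* [SchneiderStuhler1997] P. Schneider, U. Stuhler, *Representation theory and sheaves on the Bruhat–Tits building*, Publ. Math. IHÉS 85 (1997), Remark III.4.11.
* [BernsteinZelevinsky1976] I. N. Bernstein, A. V. Zelevinsky, *Representations of the group `GL(n,F)`*, Russian Math. Surveys 31 (1976), §1 (distributions on `ℓ`-groups;
  characters of `F^×` and Fourier uniqueness on `F^× ∕ U`).
-/

set_option autoImplicit false

namespace Literature.GroupTheory

open Polynomial

/-! ## §1 Transport along isomorphisms; products -/

section Transport

variable {A B : Type*} [AddCommGroup A] [AddCommGroup B]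

/-- **TRANSPORT**: if `B` is character-separated and `A ≃+ B` then `A` is character-separated. [cite: BernsteinZelevinsky1976, §1] -/
theorem finsupp_eq_zero_of_forall_addChar_of_addEquiv (e : A ≃+ B)
    (hB : ∀ Φ : B →₀ ℂ, (∀ ψ : AddChar B ℂ, Φ.sum (fun b c => c * ψ b) = 0) → Φ = 0)
    (Ψ : A →₀ ℂ) (h : ∀ ψ : AddChar A ℂ, Ψ.sum (fun a c => c * ψ a) = 0) : Ψ = 0 := by
  have key : Ψ.mapDomain e = 0 := by
    refine hB _ fun ψ => ?_
    rw [Finsupp.sum_mapDomain_index_inj e.injective]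
    have := h (ψ.compAddMonoidHom e.toAddMonoidHom)
    simpa only [AddChar.compAddMonoidHom_apply, AddEquiv.coe_toAddMonoidHom] using this
  exact Finsupp.mapDomain_injective e.injective (by rw [key, Finsupp.mapDomain_zero])

/-- **PRODUCTS**: if `A` and `B` are character-separated then so is `A × B` (fix `φ ∈ Â(B)`, contract `Ψ` along `φ` to a finitely supported function on `A`, test it against all
`ψ ∈ Â(A)` through the character `(a, b) ↦ ψ(a) φ(b)`, conclude fibrewise). [cite: BernsteinZelevinsky1976, §1] -/
theorem finsupp_eq_zero_of_forall_addChar_prod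
    (hA : ∀ Φ : A →₀ ℂ, (∀ ψ : AddChar A ℂ, Φ.sum (fun a c => c * ψ a) = 0) → Φ = 0)
    (hB : ∀ Φ : B →₀ ℂ, (∀ ψ : AddChar B ℂ, Φ.sum (fun b c => c * ψ b) = 0) → Φ = 0)
    (Ψ : A × B →₀ ℂ) (h : ∀ ψ : AddChar (A × B) ℂ, Ψ.sum (fun x c => c * ψ x) = 0) : Ψ = 0 := by
  -- the curried family `F a = Ψ(a, ·)`
  set F : A →₀ (B →₀ ℂ) := Ψ.curry with hF
  -- each fibre is killed by every character of `B`
  have hfib : ∀ (a : A) (φ : AddChar B ℂ), (F a).sum (fun b c => c * φ b) = 0 := by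
    intro a φ
    -- the contraction along `φ`
    set Φ : A →₀ ℂ := F.mapRange (fun g : B →₀ ℂ => g.sum fun b c => c * φ b) (by simp) with hΦ
    have hΦ0 : Φ = 0 := by
      refine hA Φ fun ψ => ?_
      -- the product character
      let χ : AddChar (A × B) ℂ := (ψ.compAddMonoidHom (AddMonoidHom.fst A B)) * (φ.compAddMonoidHom (AddMonoidHom.snd A B))
      have hχ : ∀ p : A × B, χ p = ψ p.1 * φ p.2 := fun p => by
        simp only [χ, AddChar.mul_apply, AddChar.compAddMonoidHom_apply, AddMonoidHom.coe_fst, AddMonoidHom.coe_snd]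
      have hsum := h χ
      simp_rw [hχ] at hsum
      rw [hΦ, Finsupp.sum_mapRange_index (fun a => by simp)]
      simp_rw [Finsupp.sum_mul]
      rw [hF, Finsupp.sum_curry_index Ψ (fun a g c => c * φ g * ψ a)]
      rw [← hsum]
      exact Finsupp.sum_congr fun p _ => by ring
    have := DFunLike.congr_fun hΦ0 a
    rwa [hΦ, Finsupp.mapRange_apply, Finsupp.zero_apply] at this
  ext ⟨a, b⟩
  have hFa : F a = 0 := hB (F a) (hfib a)
  have := DFunLike.congr_fun hFa b
  rw [hF, Finsupp.curry_apply] at this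
  simpa using this

end Transport

/-! ## §2 The integers: Laurent polynomials vanishing on `ℂ^×` -/

section Int

/-- **A finitely supported `Ψ : ℤ →₀ ℂ` with `Σ_n Ψ(n) zⁿ = 0` for every `z ≠ 0` is zero** (the Laurent polynomial `Σ Ψ(n) zⁿ` times `z^{−min supp}` is a polynomial with
infinitely many roots; its constant coefficient is `Ψ(min supp)`). [cite: BernsteinZelevinsky1976, §1] -/
theorem finsupp_int_eq_zero_of_forall_sum_mul_zpow_eq_zero (Ψ : ℤ →₀ ℂ) (h : ∀ z : ℂ, z ≠ 0 → Ψ.sum (fun n c => c * z ^ n) = 0) : Ψ = 0 := by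
  by_contra hne
  have hs : Ψ.support.Nonempty := Finsupp.support_nonempty_iff.2 hne
  set m : ℤ := Ψ.support.min' hs with hm
  have hmle : ∀ n ∈ Ψ.support, m ≤ n := fun n hn => Finset.min'_le _ _ hn
  set q : ℂ[X] := ∑ n ∈ Ψ.support, C (Ψ n) * X ^ (n - m).toNat with hq
  have heval : ∀ z : ℂ, z ≠ 0 → q.eval z = 0 := by
    intro z hz
    have hq' : q.eval z = z ^ (-m) * Ψ.sum (fun n c => c * z ^ n) := by
      rw [hq, Polynomial.eval_finsetSum, Finsupp.sum, Finset.mul_sum]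
      refine Finset.sum_congr rfl fun n hn => ?_
      rw [Polynomial.eval_mul, Polynomial.eval_C, Polynomial.eval_pow, Polynomial.eval_X, ← zpow_natCast,
        Int.toNat_of_nonneg (sub_nonneg.2 (hmle n hn)), zpow_sub₀ hz, zpow_neg, div_eq_mul_inv]
      ring
    rw [hq', h z hz, mul_zero]
  have hq0 : q = 0 := by
    refine Polynomial.eq_zero_of_infinite_isRoot q (Set.Infinite.mono (fun z (hz : z ∈ ({0}ᶜ : Set ℂ)) => heval z hz) ?_)
    rw [Set.compl_eq_univ_sdiff]
    exact Set.infinite_univ.sdiff (Set.finite_singleton 0)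
  have hcoeff : q.coeff 0 = Ψ m := by
    rw [hq, Polynomial.finsetSum_coeff, Finset.sum_eq_single m]
    · rw [sub_self, Int.toNat_zero, pow_zero, mul_one, Polynomial.coeff_C_zero]
    · intro n hn hnm
      rw [Polynomial.coeff_C_mul, Polynomial.coeff_X_pow, if_neg, mul_zero]
      intro h0
      have h2 : n - m ≤ 0 := Int.toNat_eq_zero.1 h0.symm
      exact hnm (le_antisymm (by linarith) (hmle n hn))
    · intro hm'
      exact absurd (Finset.min'_mem _ hs) hm'
  have hΨm : Ψ m = 0 := by rw [← hcoeff, hq0, Polynomial.coeff_zero]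
  exact (Finsupp.mem_support_iff.1 (Finset.min'_mem _ hs)) hΨm

/-- **`ℤ` IS CHARACTER-SEPARATED**: a finitely supported `Ψ : ℤ →₀ ℂ` killed by every `ψ : AddChar ℤ ℂ` is zero (test against the characters `n ↦ zⁿ`, `z ∈ ℂ^×`).
[cite: BernsteinZelevinsky1976, §1] -/
theorem finsupp_int_eq_zero_of_forall_addChar (Ψ : ℤ →₀ ℂ) (h : ∀ ψ : AddChar ℤ ℂ, Ψ.sum (fun n c => c * ψ n) = 0) : Ψ = 0 := by
  refine finsupp_int_eq_zero_of_forall_sum_mul_zpow_eq_zero Ψ fun z hz => ?_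
  let ψ : AddChar ℤ ℂ := { toFun := fun n => z ^ n, map_zero_eq_one' := zpow_zero z, map_add_eq_mul' := fun a b => zpow_add₀ hz a b }
  exact h ψ

end Int

/-! ## §3 Finite abelian groups: characters span all functions -/

section Finite

variable {A : Type*} [AddCommGroup A]

/-- **A FINITE ABELIAN GROUP IS CHARACTER-SEPARATED**: a finitely supported `Ψ : A →₀ ℂ` killed by every `ψ : AddChar A ℂ` is zero — the indicator of a point is a `ℂ`-combination
of characters (Mathlib `AddChar.complexBasis`). [cite: BernsteinZelevinsky1976, §1] -/
theorem finsupp_eq_zero_of_forall_addChar_of_finite [Finite A] (Ψ : A →₀ ℂ) (h : ∀ ψ : AddChar A ℂ, Ψ.sum (fun a c => c * ψ a) = 0) : Ψ = 0 := by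
  classical
  cases nonempty_fintype A
  ext a
  let δ : A → ℂ := fun x => if x = a then 1 else 0
  have hδ := (AddChar.complexBasis A).sum_repr δ
  have hδx : ∀ x, δ x = ∑ ψ : AddChar A ℂ, (AddChar.complexBasis A).repr δ ψ * ψ x := by
    intro x
    have hx := congr_fun hδ x
    simp only [Finset.sum_apply, Pi.smul_apply, AddChar.coe_complexBasis, smul_eq_mul] at hx
    exact hx.symm
  have h1 : Ψ a = Ψ.sum (fun x c => c * δ x) := by
    rw [Finsupp.sum]
    by_cases ha : a ∈ Ψ.support
    · rw [Finset.sum_eq_single a]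
      · simp [δ]
      · intro x _ hxa; simp [δ, hxa]
      · intro ha'; exact absurd ha ha'
    · rw [Finsupp.notMem_support_iff.1 ha, Finset.sum_eq_zero]
      intro x hx
      have hxa : x ≠ a := fun hxa => ha (hxa ▸ hx)
      simp [δ, hxa]
  rw [h1, Finsupp.zero_apply, Finsupp.sum]
  simp_rw [hδx, Finset.mul_sum]
  rw [Finset.sum_comm]
  refine Finset.sum_eq_zero fun ψ _ => ?_
  have hψ := h ψ
  rw [Finsupp.sum] at hψ
  calc ∑ x ∈ Ψ.support, Ψ x * ((AddChar.complexBasis A).repr δ ψ * ψ x)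
      = (AddChar.complexBasis A).repr δ ψ * ∑ x ∈ Ψ.support, Ψ x * ψ x := by
        rw [Finset.mul_sum]; exact Finset.sum_congr rfl fun x _ => by ring
    _ = 0 := by rw [hψ, mul_zero]

/-- Function form on a finite abelian group: `Σ_a Ψ(a) ψ(a) = 0` for all characters `ψ` forces `Ψ = 0`. [cite: BernsteinZelevinsky1976, §1] -/
theorem eq_zero_of_forall_addChar_of_fintype [Fintype A] (Ψ : A → ℂ) (h : ∀ ψ : AddChar A ℂ, ∑ a, Ψ a * ψ a = 0) : Ψ = 0 := by
  classical
  have hΦ : (Finsupp.equivFunOnFinite.symm Ψ : A →₀ ℂ) = 0 := by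
    refine finsupp_eq_zero_of_forall_addChar_of_finite _ fun ψ => ?_
    rw [Finsupp.sum_fintype _ _ (fun a => by simp)]
    simpa only [Finsupp.coe_equivFunOnFinite_symm] using h ψ
  funext a
  have := DFunLike.congr_fun hΦ a
  simpa only [Finsupp.coe_equivFunOnFinite_symm, Finsupp.zero_apply, Pi.zero_apply] using this

end Finite

/-! ## §4 Assembly: `ℤ × F`, `F × ℤ` and their isomorphs -/

section Assembly

variable {F : Type*} [AddCommGroup F] [Finite F]

/-- **`ℤ × F` IS CHARACTER-SEPARATED** (`F` finite). [cite: BernsteinZelevinsky1976, §1] [cite: Laumon1995, (5.6)] -/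
theorem finsupp_int_prod_eq_zero_of_forall_addChar (Ψ : ℤ × F →₀ ℂ) (h : ∀ ψ : AddChar (ℤ × F) ℂ, Ψ.sum (fun x c => c * ψ x) = 0) : Ψ = 0 :=
  finsupp_eq_zero_of_forall_addChar_prod finsupp_int_eq_zero_of_forall_addChar finsupp_eq_zero_of_forall_addChar_of_finite Ψ h

/-- **`F × ℤ` IS CHARACTER-SEPARATED** (`F` finite). [cite: BernsteinZelevinsky1976, §1] -/
theorem finsupp_prod_int_eq_zero_of_forall_addChar (Ψ : F × ℤ →₀ ℂ) (h : ∀ ψ : AddChar (F × ℤ) ℂ, Ψ.sum (fun x c => c * ψ x) = 0) : Ψ = 0 :=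
  finsupp_eq_zero_of_forall_addChar_prod finsupp_eq_zero_of_forall_addChar_of_finite finsupp_int_eq_zero_of_forall_addChar Ψ h

/-- Anything ISOMORPHIC to `ℤ × F` (`F` finite) is character-separated — e.g. `T ∕ T₁` for the split rank-one torus modulo a compact open subgroup.
[cite: BernsteinZelevinsky1976, §1] [cite: Laumon1995, (5.6)] -/
theorem finsupp_eq_zero_of_forall_addChar_of_addEquiv_int_prod {A : Type*} [AddCommGroup A] (e : A ≃+ ℤ × F)
    (Ψ : A →₀ ℂ) (h : ∀ ψ : AddChar A ℂ, Ψ.sum (fun a c => c * ψ a) = 0) : Ψ = 0 :=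
  finsupp_eq_zero_of_forall_addChar_of_addEquiv e finsupp_int_prod_eq_zero_of_forall_addChar Ψ h

end Assembly

/-! ## §5 Multiplicative groups; the `T ∕ T₁` packaging -/

section Multiplicative

variable {D : Type*} [CommGroup D]

/-- **MULTIPLICATIVE FORM**: for a commutative group `D` whose additive copy `Additive D` is character-separated, a finitely supported `Ψ : D →₀ ℂ` with `Σ_d Ψ(d) χ(d) = 0` for every
homomorphism `χ : D →* ℂ` is zero. [cite: BernsteinZelevinsky1976, §1] -/
theorem finsupp_eq_zero_of_forall_monoidHom
    (hD : ∀ Φ : Additive D →₀ ℂ, (∀ ψ : AddChar (Additive D) ℂ, Φ.sum (fun a c => c * ψ a) = 0) → Φ = 0)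
    (Ψ : D →₀ ℂ) (h : ∀ χ : D →* ℂ, Ψ.sum (fun d c => c * χ d) = 0) : Ψ = 0 := by
  have key : Ψ.mapDomain (Additive.ofMul : D → Additive D) = 0 := by
    refine hD _ fun ψ => ?_
    rw [Finsupp.sum_mapDomain_index_inj Additive.ofMul.injective]
    -- the homomorphism `d ↦ ψ (ofMul d)`
    let χ : D →* ℂ :=
      { toFun := fun d => ψ (Additive.ofMul d)
        map_one' := (by rw [ofMul_one, AddChar.map_zero_eq_one])
        map_mul' := fun a b => (by rw [ofMul_mul, AddChar.map_add_eq_mul]) }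
    exact h χ
  exact Finsupp.mapDomain_injective Additive.ofMul.injective (by rw [key, Finsupp.mapDomain_zero])

variable {T : Type*} [CommGroup T]

/-- **THE `T ∕ T₁` PACKAGING** (census row 47 (A5)): `T` a commutative group, `T₁ ≤ T`, `Ψ : T → ℂ` INVARIANT under `T₁` and carried by FINITELY many `T₁`-cosets; if `T ∕ T₁` is
character-separated (additive copy) and `Σ_{c} Ψ(c) χ(c) = 0` — the sum over the finitely many carrying cosets, `Ψ(c) := Ψ(c.out)` — for every homomorphism `χ : T →* ℂ`
TRIVIAL ON `T₁`, then `Ψ = 0`. [cite: Laumon1995, (5.6)] [cite: BernsteinZelevinsky1976, §1] -/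
theorem eq_zero_of_forall_monoidHom_quotient (T₁ : Subgroup T)
    (hD : ∀ Φ : Additive (T ⧸ T₁) →₀ ℂ, (∀ ψ : AddChar (Additive (T ⧸ T₁)) ℂ, Φ.sum (fun a c => c * ψ a) = 0) → Φ = 0)
    (Ψ : T → ℂ) (hinv : ∀ (t u : T), u ∈ T₁ → Ψ (t * u) = Ψ t)
    (hfin : ((QuotientGroup.mk : T → T ⧸ T₁) '' Function.support Ψ).Finite)
    (h : ∀ χ : T →* ℂ, (∀ u ∈ T₁, χ u = 1) → ∑ c ∈ hfin.toFinset, Ψ c.out * χ c.out = 0) : Ψ = 0 := by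
  classical
  -- `Ψ` is constant on cosets: `Ψ (c.out) = Ψ t` for `c = mk t`
  have hout : ∀ t : T, Ψ ((QuotientGroup.mk t : T ⧸ T₁).out) = Ψ t := by
    intro t
    obtain ⟨u, hu⟩ := QuotientGroup.mk_out_eq_mul T₁ t
    rw [hu, hinv t u u.2]
  -- the induced finitely supported function on `T ⧸ T₁`
  have hsupp : ∀ c : T ⧸ T₁, Ψ c.out ≠ 0 → c ∈ hfin.toFinset := by
    intro c hc
    rw [Set.Finite.mem_toFinset]
    exact ⟨c.out, hc, QuotientGroup.out_eq' c⟩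
  set Φ : (T ⧸ T₁) →₀ ℂ := Finsupp.onFinset hfin.toFinset (fun c => Ψ c.out) hsupp with hΦ
  have hΦ0 : Φ = 0 := by
    refine finsupp_eq_zero_of_forall_monoidHom hD Φ fun χ' => ?_
    rw [hΦ, Finsupp.onFinset_sum hsupp (fun c => by simp)]
    have hχ := h (χ'.comp (QuotientGroup.mk' T₁)) fun u hu => by
      rw [MonoidHom.comp_apply, QuotientGroup.mk'_apply, (QuotientGroup.eq_one_iff u).2 hu, map_one]
    refine (Finset.sum_congr rfl fun c _ => ?_).trans hχ
    rw [MonoidHom.comp_apply, QuotientGroup.mk'_apply, QuotientGroup.out_eq']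
  funext t
  have := DFunLike.congr_fun hΦ0 (QuotientGroup.mk t)
  rw [hΦ, Finsupp.onFinset_apply, Finsupp.zero_apply, hout] at this
  exact this

/-- **THE `T ∕ T₁` PACKAGING WITH `T ∕ T₁ ≅ ℤ × F`** (`F` finite; the split rank-one torus modulo a compact open subgroup): a `T₁`-invariant `Ψ : T → ℂ` carried by finitely many
cosets whose coset sums against every `T₁`-trivial homomorphism `χ : T →* ℂ` vanish is zero. [cite: Laumon1995, (5.6)] [cite: BernsteinZelevinsky1976, §1] -/
theorem eq_zero_of_forall_monoidHom_of_addEquiv_int_prod (T₁ : Subgroup T) {F : Type*} [AddCommGroup F] [Finite F]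
    (e : Additive (T ⧸ T₁) ≃+ ℤ × F)
    (Ψ : T → ℂ) (hinv : ∀ (t u : T), u ∈ T₁ → Ψ (t * u) = Ψ t)
    (hfin : ((QuotientGroup.mk : T → T ⧸ T₁) '' Function.support Ψ).Finite)
    (h : ∀ χ : T →* ℂ, (∀ u ∈ T₁, χ u = 1) → ∑ c ∈ hfin.toFinset, Ψ c.out * χ c.out = 0) : Ψ = 0 :=
  eq_zero_of_forall_monoidHom_quotient T₁ (finsupp_eq_zero_of_forall_addChar_of_addEquiv_int_prod e) Ψ hinv hfin h

end Multiplicative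

end Literature.GroupTheory
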